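import Literature.MathematicalPhysics.QuantumFieldTheory.Balaban1983to89.B9Eq315QTorus
import Literature.MathematicalPhysics.QuantumFieldTheory.Balaban1983to89.B7Eq125RightInverse
import Literature.MathematicalPhysics.QuantumFieldTheory.Balaban1983to89.B7Prop3GeneralLinearBound
import Literature.MathematicalPhysics.QuantumFieldTheory.Balaban1983to89.B9Eq326OperatorSymmetric

/-!
# `Balaban1983to89.B9Eq315QTorusOnto` — T. Bałaban, *Propagators for lattice gauge theories in a background field*, Commun. Math. Phys.
# **99** (1985) 389–434 [Balaban1985BackgroundPropagators] (3.15) p. 393, (3.126) p. 420 with [Balaban1985Averaging] (124)–(126) p. 36 and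
# [Balaban1985Variational] (45) p. 285: THE ONE-STEP COVARIANT VECTOR AVERAGING `Q(U)` ON THE TORUS IS ONTO in the small-field regime —
# hence `QG₁Q*` is invertible and `H₁ = G₁Q*(QG₁Q*)⁻¹` ((3.126)), `𝔊` of the (L6)/(L2) letters exist at `Q := Q(U)` with NO surjectivity
# hypothesis; and `Δ_a(U)` with `Q := Q(U)` is symmetric

statement-level skeleton of published theorems with citation tags; proofs where landed; nothing here is a claim
about the Yang–Mills mass gap

PDF held: `paper:balaban1985-cmp99-background-propagators` (journal page = PDF page + 388) pp. 393–394, `paper:balaban1985-cmp98-averaging` p. 36,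
`paper:balaban1985-cmp102-variational-background` pp. 285, 293; read by this seat (2026-08-21) in the held texts.

THE PRINT (verbatim).  [B9] p. 393: *«We are interested in the linear operators Q_j(U). They are compositions of j one-step averaging operators
Q_j(U) = Q(Ū^{j−1})…Q(Ū)Q(U), (3.15) where Q(V) is given by the explicit formula (124) in [5].»*  [B7] p. 36: *«|(Q(V₀)A)_c| ≤ |A| + O(1)L²α₀|A| <
(1 + O(1)L²α₀)α₁ (126)»*, *«(Q₀A)_c = (Q_{V₀}A)_c = Σ_{x∈B(c₋)} L^{−(d+1)}(R_{0,c₋}A)([x, x′]) (125)»*.  [B9] (3.126) p. 420: *«HB =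
GQ*(QGQ*)⁻¹B»* (the operators `G₁`, `H₁` of p. 421; [B11] (45) p. 285 lists the properties `L^jηQ_jHB = B, RD*HB = 0`, p. 298 uses (3.126));
[B9] (3.25) p. 394: *«Rf = (I − G′Q′*(Q′G′²Q′*)⁻¹Q′G′)f»*.  Print inverts `QG₁Q*` without comment; for a positive `G₁` this is exactly `Q*`
injective, i.e. `Q` ONTO — displayed as the hypothesis `hQ` of `B11Eq103H1Complex.H1LatticeK` / `B9Eq326OperatorAssembly.H1ofU`.

WHY THIS FILE (cell context).  After `B9Eq315QTorus` (p297270) the assembled `Δ_a(U)` (`laplaceAofBackground`) has no operator DATA left; its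
letters `G₁`/`H₁`/`𝔊` still displayed «`Q` onto» for the VECTOR averaging (for the scalar `Q′` it is `B9Eq319QprimeTorus.Qprime_surjective`).  This
file DISCHARGES it in the small-field regime: the main term `Q₀(V₀)` of (125) has the EXACT right inverse `S` of `B7Eq125RightInverse` (every
background), the NE7c crew PROVED (126) in the form `‖L(Q(V₀)A)_c − L·(Q₀A)_c‖ ≤ 50(d+1)·ε·L·|A|` (`B7Prop3GeneralLinearBound.norm_linQcov_sub_main_le`,
`ε` = block-loop regularity), so `Q(U)∘S = 1 + K` with `‖K‖ ≤ 50(d+1)·ε·L^d ≤ ½` on the Banach space of coarse bond functions — invertible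
(Neumann series, `Units.oneSub`) — and `Q(U)` is onto.

WHAT IS DEFINED AND PROVED (sorry-free; no `Prop` placeholder; no inequality of the paper asserted as a hypothesis-free fact beyond the crew's
PROVED (126)).
* §1 periodicity bookkeeping: `liftSite`, `perSite_add_period`, `hol_perCfg_add_period` (holonomies of a periodic background are period-invariant),
  `coarseW` (the coarse bond function read periodically on `ℤ^d`), `secCfg_add_period`, **`secT`** (the section `S` ON THE TORUS) with
  **`perCfg_secT`** (its periodic extension IS `B7Eq125RightInverse.secCfg` of the extended data), `secTLin`.
* §2 **`norm_QtorusAt_secT_sub_le`**: `‖(Q(U)(S w))(y, κ) − w(y, κ)‖ ≤ 50(d+1)·α·L^d·‖w‖`; **`norm_QtorusLin_secT_sub_le`** (sup-norm form).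
* §3 **`exists_preimage_norm_le`** (QUANTITATIVE right inverse: for `50(d+1)·α·L^d ≤ 1/2` every `v` is `Q(U)A` with `‖A‖ ≤ 2L^d‖v‖`),
  **`QtorusLin_surjective`** (`Q(U)` of (3.15) on the torus is ONTO), **`QtorusW_surjective`** (the `L²`/Hilbert-fibre reading of
  `B9Eq315QTorus.QtorusW`).
* §4 **`laplaceAofBackground_isSymmetric`** (E161's `laplaceAofU_isSymmetric` at `Q := Q(U)`), and the letters **`G1ofBackground`**, **`H1ofBackground`**
  (+ **`Q_H1ofBackground`** = (45)₁ `Q(H₁b) = b`), **`frakGofBackground`** with «`Q` onto» DISCHARGED — displayed: positivity of `Δ_a(U)` ([B9] Thm 3.11)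
  only.
MODEL / DECLARED READINGS.  (M1) as `B9Eq315QTorus`: torus `TSite d (L·m)`, periodic extension to the b07 carriers `ℤ^d`, `Q(U)` = `L⁻¹ •` the
derivative-defined linear part `linQcov` at the block corners (READING C-adv4-22).  (M2) the smallness `50(d+1)·α·L^d ≤ 1/2` on the block-loop
regularity `α` of the extended background (print: `α = O(L²α₀)`, «α₀, α₁ sufficiently small», Prop. 3 p. 36 «c₃ depends on d and L») — a
sufficient, not a sharp, condition; the constant `50(d+1)` is the crew's witness for print's `O(1)`.  (M3) one averaging level.
HONEST SCOPE.  Finite-dimensional/Banach linear algebra on top of the crew's PROVED (126) and this lineage's exact right inverse of (125); NO bound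
of [B9]/[B11] Sect. C–G asserted; positivity (Thm 3.11) stays displayed; NOT summit progress (cell pub-balaban: NE9 NOT PRINTED / NOT PROVED; spine
PROVED 0/9).  Filed by the pub-balaban NE9 BINDER-row owner lineage `b2b-balaban-t4-ne9-p1` (gen 78); NEW file; nothing modified.  Net new unproved
facts: 0.
-/

noncomputable section

open scoped BigOperators InnerProductSpace ComplexConjugate
open Finset

namespace Literature.MathematicalPhysics.QuantumFieldTheory.Balaban1983to89.B9Eq315QTorusOnto

open B4Sect5Torus (TSite)
open B9SectCLatticeCarrier (Bond)
open B7Prop1Explicit (U1 Wcx boxVec hol stepHol e Letter)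
open B7Prop3GeneralLinear (linQcov Q0cov)
open B7Prop3GeneralLinearBound (norm_linQcov_sub_main_le)
open B7Eq125RightInverse (corner blk spineSite secCfg secCfgLin secCfgLin_apply corner_add corner_apply blk_apply norm_secCfg_le Q0cov_secCfg)
open B9Eq319QprimeTorus (fineP centre blockCoord blockCoord_centre)
open B9Eq315QTorus (perSite perCfg perCfg_apply perCfgLin cornerSite QtorusAt QtorusAt_apply QtorusLin QtorusLin_apply QtorusW laplaceAofBackground)
open B9Eq311L2Pairing (WL2)
open B11Eq103H1Complex (BondL2K)
open B9Eq326OperatorAssembly (laplaceAofU G1ofU H1ofU Q_H1ofU frakGofU)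
open B9Eq326OperatorSymmetric (laplaceAofU_isSymmetric)

variable {d : ℕ}

/-! ## §1 Periodicity: the section `S` on the torus -/

section Periodic

/-- The canonical representative in `ℤ^d` of a torus site (coordinates in `[0, P_i)`). [cite: Balaban1985Averaging, (1) p.17] -/
def liftSite {P : Fin d → ℕ} (z : TSite d P) : B7Prop1Explicit.Site d := fun i => ((z i : ℕ) : ℤ)

/-- The period vector `(P_i t_i)_i` of an integer multi-index `t`. [cite: Balaban1985Averaging, (1) p.17] -/
def periodVec (P : Fin d → ℕ) (t : B7Prop1Explicit.Site d) : B7Prop1Explicit.Site d := fun i => (P i : ℤ) * t i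

variable (P : Fin d → ℕ) [∀ i, NeZero (P i)]

/-- Reading a site on the torus is invariant under the periods. [cite: Balaban1985Averaging, (1) p.17] -/
theorem perSite_add_periodVec (x t : B7Prop1Explicit.Site d) : perSite P (x + periodVec P t) = perSite P x := by
  funext i
  apply Fin.ext
  simp only [perSite, periodVec, Pi.add_apply, Int.add_mul_emod_self_left]

/-- A site is its representative plus a period vector. [cite: Balaban1985Averaging, (1) p.17] -/
theorem liftSite_perSite_add (x : B7Prop1Explicit.Site d) :
    liftSite (perSite P x) + periodVec P (fun i => x i / (P i : ℤ)) = x := by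
  funext i
  have hP : (0 : ℤ) < (P i : ℤ) := by exact_mod_cast Nat.pos_of_ne_zero (NeZero.ne (P i))
  simp only [liftSite, perSite, periodVec, Pi.add_apply, Int.toNat_of_nonneg (Int.emod_nonneg _ hP.ne')]
  exact Int.emod_add_mul_ediv _ _

/-- The representative read back on the torus is the site. [cite: Balaban1985Averaging, (1) p.17] -/
theorem perSite_liftSite (z : TSite d P) : perSite P (liftSite z) = z := by
  funext i
  apply Fin.ext
  have h1 : ((z i : ℕ) : ℤ) % (P i : ℤ) = ((z i : ℕ) : ℤ) := Int.emod_eq_of_lt (by positivity) (by exact_mod_cast (z i).isLt)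
  simp only [perSite, liftSite, h1, Int.toNat_natCast]

variable {G : Type*} [Group G]

/-- **Holonomies of a periodic background are invariant under the periods.** [cite: Balaban1985Averaging, (9) p.18, (1) p.17] -/
theorem hol_perCfg_add_periodVec (U : Bond d P → G) (t : B7Prop1Explicit.Site d) :
    ∀ (x : B7Prop1Explicit.Site d) (wrd : List (Letter d)), hol (perCfg P U) (x + periodVec P t) wrd = hol (perCfg P U) x wrd
  | x, [] => rfl
  | x, l :: wrd => by
    rw [B7Prop1Explicit.hol_cons, B7Prop1Explicit.hol_cons, add_right_comm, hol_perCfg_add_periodVec U t (x + l.vec) wrd]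
    congr 1
    unfold stepHol
    split_ifs
    · rw [perCfg_apply, perCfg_apply, perSite_add_periodVec]
    · rw [perCfg_apply, perCfg_apply, add_right_comm, perSite_add_periodVec]

end Periodic

section TorusSection

variable {𝔸 : Type*} [NormedRing 𝔸] [NormedAlgebra ℂ 𝔸]
  (L : ℕ) (m : Fin d → ℕ) [∀ i, NeZero (fineP L m i)] (U : Bond d (fineP L m) → 𝔸ˣ)

/-- **The coarse bond function read periodically on `ℤ^d`**: at the block index `Y ∈ ℤ^d` the value of `w` at the coarse torus site of the block
containing the (periodically read) corner `L·Y`. [cite: Balaban1985Averaging, (1)–(2) p.17] -/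
def coarseW (w : Bond d m → 𝔸) : B7Prop1Explicit.Site d → Fin d → 𝔸 :=
  fun Y κ => w (blockCoord L m (perSite (fineP L m) (corner L Y)), κ)

omit [NormedRing 𝔸] [NormedAlgebra ℂ 𝔸] in
/-- `coarseW` is invariant under the coarse periods `m`. [cite: Balaban1985Averaging, (1)–(2) p.17] -/
theorem coarseW_add (w : Bond d m → 𝔸) (Y t : B7Prop1Explicit.Site d) (κ : Fin d) :
    coarseW L m w (Y + fun i => (m i : ℤ) * t i) κ = coarseW L m w Y κ := by
  unfold coarseW
  rw [corner_add, show corner L (fun i => (m i : ℤ) * t i) = periodVec (fineP L m) t by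
    funext i; simp only [corner_apply, periodVec, fineP, Nat.cast_mul]; ring, perSite_add_periodVec]

omit [NormedRing 𝔸] [NormedAlgebra ℂ 𝔸] in
/-- `coarseW` at the representative block index of a coarse torus site is the value there. [cite: Balaban1985Averaging, (1)–(2) p.17] -/
theorem coarseW_liftSite [NeZero L] (w : Bond d m → 𝔸) (y : TSite d m) (κ : Fin d) :
    coarseW L m w (liftSite y) κ = w (y, κ) := by
  unfold coarseW
  have h : perSite (fineP L m) (corner L (liftSite y)) = centre L m y := by
    funext i
    apply Fin.ext
    have hlt : (L : ℤ) * ((y i : ℕ) : ℤ) < ((L * m i : ℕ) : ℤ) := by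
      push_cast; exact mul_lt_mul_of_pos_left (by exact_mod_cast (y i).isLt) (by exact_mod_cast Nat.pos_of_ne_zero (NeZero.ne L))
    have h1 : ((L : ℤ) * ((y i : ℕ) : ℤ)) % ((fineP L m i : ℕ) : ℤ) = (L : ℤ) * ((y i : ℕ) : ℤ) := Int.emod_eq_of_lt (by positivity) hlt
    simp only [perSite, corner_apply, liftSite, h1, B9Eq319QprimeTorus.centre_apply_val]
    exact_mod_cast Int.toNat_natCast (L * (y i : ℕ))
  rw [h, blockCoord_centre]

omit [∀ i, NeZero (fineP L m i)] in
/-- the period vectors of the fine torus are `L`-multiples: `(L·m_i·t_i)_i = L·(m_i t_i)_i`. [cite: Balaban1985Averaging, (1)–(2) p.17] -/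
theorem periodVec_fineP (t : B7Prop1Explicit.Site d) : periodVec (fineP L m) t = corner L (fun i => (m i : ℤ) * t i) := by
  funext i; simp only [corner_apply, periodVec, fineP, Nat.cast_mul]; ring

omit [∀ i, NeZero (fineP L m i)] in
/-- the block index is shifted by `s` under a shift by `L·s`. [cite: Balaban1985Averaging, (2) p.17] -/
theorem blk_add_corner [NeZero L] (x s : B7Prop1Explicit.Site d) : blk L (x + corner L s) = blk L x + s := by
  funext i
  have hL : (L : ℤ) ≠ 0 := by exact_mod_cast NeZero.ne L
  simp only [blk_apply, Pi.add_apply, corner_apply]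
  rw [mul_comm, Int.add_mul_ediv_right _ _ hL]

/-- **The `ℤ^d` section of the periodically extended data is periodic** (fine periods `L·m`). [cite: Balaban1985Averaging, (125) p.36, (1) p.17] -/
theorem secCfg_add_periodVec [NeZero L] (w : Bond d m → 𝔸) (x t : B7Prop1Explicit.Site d) (κ : Fin d) :
    secCfg L (perCfg (fineP L m) U) (coarseW L m w) (x + periodVec (fineP L m) t) κ =
      secCfg L (perCfg (fineP L m) U) (coarseW L m w) x κ := by
  have hblk : blk L (x + periodVec (fineP L m) t) = blk L x + fun i => (m i : ℤ) * t i := by rw [periodVec_fineP, blk_add_corner L]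
  have hsp : spineSite L κ (blk L x + fun i => (m i : ℤ) * t i) = spineSite L κ (blk L x) + periodVec (fineP L m) t := by
    rw [spineSite, spineSite, corner_add, periodVec_fineP]; abel
  have hcor : corner L (blk L x + fun i => (m i : ℤ) * t i) = corner L (blk L x) + periodVec (fineP L m) t := by
    rw [corner_add, periodVec_fineP]
  unfold secCfg
  rw [hblk, hsp, hcor, coarseW_add, hol_perCfg_add_periodVec]
  by_cases h : x = spineSite L κ (blk L x)
  · rw [if_pos (by rw [← h]), if_pos h]
  · rw [if_neg (fun h' => h (add_right_cancel h')), if_neg h]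

/-- **THE SECTION `S` ON THE TORUS**: the `ℤ^d` section `B7Eq125RightInverse.secCfg` of the periodically extended background and coarse data, read
at the representatives. [cite: Balaban1985Averaging, (125) p.36] -/
def secT (w : Bond d m → 𝔸) : Bond d (fineP L m) → 𝔸 :=
  fun b => secCfg L (perCfg (fineP L m) U) (coarseW L m w) (liftSite b.1) b.2

/-- **The periodic extension of `S w` IS the `ℤ^d` section of the extended data.** [cite: Balaban1985Averaging, (125) p.36, (1) p.17] -/
theorem perCfg_secT [NeZero L] (w : Bond d m → 𝔸) :
    perCfg (fineP L m) (secT L m U w) = secCfg L (perCfg (fineP L m) U) (coarseW L m w) := by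
  funext x κ
  rw [perCfg_apply, secT]
  conv_rhs => rw [← liftSite_perSite_add (fineP L m) x]
  rw [secCfg_add_periodVec]

/-- `S` is `ℂ`-linear on the torus. [cite: Balaban1985Averaging, (125) p.36] -/
def secTLin : (Bond d m → 𝔸) →ₗ[ℂ] (Bond d (fineP L m) → 𝔸) where
  toFun := secT L m U
  map_add' w w' := by
    funext b
    have h : coarseW L m (w + w') = coarseW L m w + coarseW L m w' := rfl
    simp only [secT, Pi.add_apply, h, ← secCfgLin_apply, map_add]
  map_smul' c w := by
    funext b
    have h : coarseW L m (c • w) = c • coarseW L m w := rfl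
    simp only [secT, Pi.smul_apply, h, ← secCfgLin_apply, map_smul, RingHom.id_apply]

/-- Unfolding. [cite: Balaban1985Averaging, (125) p.36] -/
@[simp] theorem secTLin_apply (w : Bond d m → 𝔸) : secTLin L m U w = secT L m U w := rfl

/-- **`‖(S w)(b)‖ ≤ L^d‖w‖`** for an extended background in `U1`. [cite: Balaban1985Averaging, (125)–(126) p.36] -/
theorem norm_secT_le [NormOneClass 𝔸] (hU1 : ∀ (x : B7Prop1Explicit.Site d) (κ : Fin d), perCfg (fineP L m) U x κ ∈ U1 𝔸)
    (w : Bond d m → 𝔸) (b : Bond d (fineP L m)) : ‖secT L m U w b‖ ≤ (L : ℝ) ^ d * ‖w‖ :=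
  norm_secCfg_le hU1 (norm_nonneg w) (fun _ _ => norm_le_pi_norm w _) _ _

end TorusSection

/-! ## §2 `Q(U) ∘ S = 1 + O(α L^d)` on the torus -/

section Estimate

variable {𝔸 : Type*} [NormedRing 𝔸] [NormedAlgebra ℂ 𝔸] [CompleteSpace 𝔸] [NormOneClass 𝔸]
  (L : ℕ) [NeZero L] (m : Fin d → ℕ) [∀ i, NeZero (fineP L m i)] (hL : 1 ≤ L)
  (U : Bond d (fineP L m) → 𝔸ˣ) {α : ℝ} (hα1 : α ≤ 1 / 64)
  (hU1 : ∀ (x : B7Prop1Explicit.Site d) (κ : Fin d), perCfg (fineP L m) U x κ ∈ U1 𝔸)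
  (hreg : ∀ (y : TSite d m) (κ : Fin d) (r : Fin d → Fin L),
    ‖((Wcx L (perCfg (fineP L m) U) (cornerSite L y) κ (boxVec L r) : 𝔸ˣ) : 𝔸) - 1‖ ≤ α)

omit [NeZero L] [∀ i, NeZero (fineP L m i)] in
/-- the block corner of `B9Eq315QTorus` is `corner L` of the representative. [cite: Balaban1985Averaging, (2) p.17] -/
theorem cornerSite_eq (y : TSite d m) : cornerSite L y = corner L (liftSite y) := rfl

include hL hα1 hU1 hreg in
/-- **`‖(Q(U)(S w))(y, κ) − w(y, κ)‖ ≤ 50(d+1)·α·L^d·‖w‖`** — the main term returns `w` exactly (`B7Eq125RightInverse.Q0cov_secCfg`), the rest of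
the linear part is the crew's (126) `‖L(Q(V₀)A)_c − L·(Q₀A)_c‖ ≤ 50(d+1)·α·L·|A|` at `|A| ≤ L^d‖w‖`, divided by the normalisation `L`.
[cite: Balaban1985Averaging, (124)–(126) p.36; Balaban1985BackgroundPropagators, (3.15) p.393] -/
theorem norm_QtorusAt_secT_sub_le (w : Bond d m → 𝔸) (y : TSite d m) (κ : Fin d) :
    ‖QtorusAt L m hL U hα1 hU1 hreg y κ (secT L m U w) - w (y, κ)‖ ≤ 50 * (d + 1) * α * (L : ℝ) ^ d * ‖w‖ := by
  have hL0 : (0 : ℝ) < L := by exact_mod_cast hL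
  have hα0 : 0 ≤ α := (norm_nonneg _).trans (hreg y κ fun _ => ⟨0, hL⟩)
  set Ut := perCfg (fineP L m) U with hUt
  set A := secCfg L Ut (coarseW L m w) with hA
  have hAb : ∀ x κ', ‖A x κ'‖ ≤ (L : ℝ) ^ d * ‖w‖ := fun x κ' => norm_secCfg_le hU1 (norm_nonneg w) (fun Y κ => norm_le_pi_norm w _) _ _
  have hmain : Q0cov L Ut A (corner L (liftSite y)) κ = w (y, κ) := by
    rw [hA, Q0cov_secCfg hL, coarseW_liftSite]
  have h126 := norm_linQcov_sub_main_le L hU1 (by positivity) hAb hL (corner L (liftSite y)) κ hα0 (by linarith) (hreg y κ)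
  rw [QtorusAt_apply, perCfg_secT, cornerSite_eq]
  -- `L⁻¹ • LQ − w = L⁻¹ • (LQ − L • Q₀)`
  have hid : ((L : ℂ))⁻¹ • linQcov L Ut A (corner L (liftSite y)) κ - w (y, κ) =
      ((L : ℂ))⁻¹ • (linQcov L Ut A (corner L (liftSite y)) κ - (L : ℝ) • Q0cov L Ut A (corner L (liftSite y)) κ) := by
    rw [hmain, smul_sub, ← Complex.coe_smul, Complex.ofReal_natCast, smul_smul, inv_mul_cancel₀ (by exact_mod_cast hL0.ne'),
      one_smul]
  rw [hid, norm_smul, norm_inv, Complex.norm_natCast]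
  calc (L : ℝ)⁻¹ * ‖linQcov L Ut A (corner L (liftSite y)) κ - (L : ℝ) • Q0cov L Ut A (corner L (liftSite y)) κ‖
      ≤ (L : ℝ)⁻¹ * (50 * (d + 1) * α * L * ((L : ℝ) ^ d * ‖w‖)) := mul_le_mul_of_nonneg_left h126 (by positivity)
    _ = 50 * (d + 1) * α * (L : ℝ) ^ d * ‖w‖ := by field_simp

include hα1 hU1 hreg in
/-- **sup-norm form: `‖Q(U)(S w) − w‖ ≤ 50(d+1)·α·L^d·‖w‖`.** [cite: Balaban1985Averaging, (126) p.36; Balaban1985BackgroundPropagators, (3.15) p.393] -/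
theorem norm_QtorusLin_secT_sub_le (w : Bond d m → 𝔸) :
    ‖QtorusLin L m hL U hα1 hU1 hreg (secT L m U w) - w‖ ≤ 50 * (d + 1) * α * (L : ℝ) ^ d * ‖w‖ := by
  rcases isEmpty_or_nonempty (Bond d m) with hE | ⟨⟨y₀, κ₀⟩⟩
  · have h0 : ∀ f : Bond d m → 𝔸, f = 0 := fun f => funext fun b => (hE.false b).elim
    rw [h0 (QtorusLin L m hL U hα1 hU1 hreg (secT L m U w) - w), h0 w, norm_zero, mul_zero]
  · have hα0 : 0 ≤ α := (norm_nonneg _).trans (hreg y₀ κ₀ fun _ => ⟨0, hL⟩)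
    refine (pi_norm_le_iff_of_nonneg (by positivity)).2 fun b => ?_
    obtain ⟨y, κ⟩ := b
    exact norm_QtorusAt_secT_sub_le L m hL U hα1 hU1 hreg w y κ

end Estimate

/-! ## §3 `Q(U)` is onto (Neumann series on the Banach space of coarse bond functions) -/

section Onto

variable {𝔸 : Type*} [NormedRing 𝔸] [NormedAlgebra ℂ 𝔸] [CompleteSpace 𝔸] [NormOneClass 𝔸]
  (L : ℕ) [NeZero L] (m : Fin d → ℕ) [∀ i, NeZero (fineP L m i)] (hL : 1 ≤ L)
  (U : Bond d (fineP L m) → 𝔸ˣ) {α : ℝ} (hα1 : α ≤ 1 / 64)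
  (hU1 : ∀ (x : B7Prop1Explicit.Site d) (κ : Fin d), perCfg (fineP L m) U x κ ∈ U1 𝔸)
  (hreg : ∀ (y : TSite d m) (κ : Fin d) (r : Fin d → Fin L),
    ‖((Wcx L (perCfg (fineP L m) U) (cornerSite L y) κ (boxVec L r) : 𝔸ˣ) : 𝔸) - 1‖ ≤ α)
  (hαL : 50 * (d + 1) * α * (L : ℝ) ^ d ≤ 1 / 2)

include hαL in
/-- **QUANTITATIVE RIGHT INVERSE OF `Q(U)` ON THE TORUS**: in the small-field regime `50(d+1)·α·L^d ≤ 1/2` every coarse bond function `v` is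
`Q(U)A` for some `A` with `‖A‖ ≤ 2L^d‖v‖` — `Q(U) ∘ S = 1 − K` with `‖K‖ ≤ 1/2` on the Banach space of coarse bond functions, inverted by the
Neumann series (`‖(1 − K)⁻¹‖ ≤ 2`), and `‖S‖ ≤ L^d`. [cite: Balaban1985BackgroundPropagators, (3.15) p.393; Balaban1985Averaging, (125)–(126) p.36] -/
theorem exists_preimage_norm_le (v : Bond d m → 𝔸) :
    ∃ A : Bond d (fineP L m) → 𝔸, QtorusLin L m hL U hα1 hU1 hreg A = v ∧ ‖A‖ ≤ 2 * (L : ℝ) ^ d * ‖v‖ := by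
  set T : (Bond d m → 𝔸) →ₗ[ℂ] (Bond d m → 𝔸) := QtorusLin L m hL U hα1 hU1 hreg ∘ₗ secTLin L m U with hT
  have hKb : ∀ w, ‖(LinearMap.id - T : (Bond d m → 𝔸) →ₗ[ℂ] (Bond d m → 𝔸)) w‖ ≤ 1 / 2 * ‖w‖ := fun w => by
    rw [LinearMap.sub_apply, LinearMap.id_apply, hT, LinearMap.comp_apply, secTLin_apply, norm_sub_rev]
    exact (norm_QtorusLin_secT_sub_le L m hL U hα1 hU1 hreg w).trans (mul_le_mul_of_nonneg_right hαL (norm_nonneg _))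
  set K : (Bond d m → 𝔸) →L[ℂ] (Bond d m → 𝔸) :=
    (LinearMap.id - T : (Bond d m → 𝔸) →ₗ[ℂ] (Bond d m → 𝔸)).mkContinuous (1 / 2) hKb with hK
  have hK2 : ‖K‖ ≤ 1 / 2 := LinearMap.mkContinuous_norm_le _ (by norm_num) _
  have hKn : ‖K‖ < 1 := hK2.trans_lt (by norm_num)
  set u := Units.oneSub K hKn with hu
  have huT : ∀ w, (u : (Bond d m → 𝔸) →L[ℂ] (Bond d m → 𝔸)) w = QtorusLin L m hL U hα1 hU1 hreg (secT L m U w) := fun w => by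
    rw [hu, Units.val_oneSub]
    show w - K w = _
    rw [hK, LinearMap.mkContinuous_apply, LinearMap.sub_apply, LinearMap.id_apply, hT, LinearMap.comp_apply, secTLin_apply,
      sub_sub_cancel]
  -- the Neumann series bounds the inverse: `‖(1 − K)⁻¹‖ ≤ ‖1‖ − 1 + (1 − ‖K‖)⁻¹ ≤ 2`
  have hinv : ‖((↑u⁻¹ : (Bond d m → 𝔸) →L[ℂ] (Bond d m → 𝔸)))‖ ≤ 2 := by
    have h1 : ‖(1 : (Bond d m → 𝔸) →L[ℂ] (Bond d m → 𝔸))‖ ≤ 1 := ContinuousLinearMap.norm_id_le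
    have h2 := tsum_geometric_le_of_norm_lt_one K hKn
    have h3 : (1 - ‖K‖)⁻¹ ≤ 2 := (inv_le_comm₀ (by linarith) two_pos).2 (by linarith)
    change ‖∑' n : ℕ, K ^ n‖ ≤ 2
    linarith
  refine ⟨secT L m U ((↑u⁻¹ : (Bond d m → 𝔸) →L[ℂ] (Bond d m → 𝔸)) v), ?_, ?_⟩
  · rw [← huT]
    show ((u : (Bond d m → 𝔸) →L[ℂ] (Bond d m → 𝔸)) * (↑u⁻¹ : (Bond d m → 𝔸) →L[ℂ] (Bond d m → 𝔸))) v = v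
    rw [Units.mul_inv]
    rfl
  · have hsec : ‖secT L m U ((↑u⁻¹ : (Bond d m → 𝔸) →L[ℂ] (Bond d m → 𝔸)) v)‖ ≤
        (L : ℝ) ^ d * ‖((↑u⁻¹ : (Bond d m → 𝔸) →L[ℂ] (Bond d m → 𝔸)) v)‖ :=
      (pi_norm_le_iff_of_nonneg (by positivity)).2 fun b => norm_secT_le L m U hU1 _ b
    refine hsec.trans ?_
    calc (L : ℝ) ^ d * ‖((↑u⁻¹ : (Bond d m → 𝔸) →L[ℂ] (Bond d m → 𝔸)) v)‖
        ≤ (L : ℝ) ^ d * (2 * ‖v‖) :=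
          mul_le_mul_of_nonneg_left ((ContinuousLinearMap.le_opNorm _ v).trans
            (mul_le_mul_of_nonneg_right hinv (norm_nonneg v))) (by positivity)
      _ = 2 * (L : ℝ) ^ d * ‖v‖ := by ring

include hαL in
/-- **THE ONE-STEP COVARIANT VECTOR AVERAGING `Q(U)` OF (3.15) IS ONTO ON THE TORUS** in the small-field regime `50(d+1)·α·L^d ≤ 1/2`
(`α` the block-loop regularity of the background) — the hypothesis behind the inversions `(QG₁Q*)⁻¹` of [B9] (3.126) / [B11] (45) and
`(Q′G′²Q′*)⁻¹` of [B9] (3.25). [cite: Balaban1985BackgroundPropagators, (3.15) p.393, (3.25) p.394, (3.126) p.420; Balaban1985Variational, (45) p.285; Balaban1985Averaging, (125)–(126) p.36] -/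
theorem QtorusLin_surjective : Function.Surjective (QtorusLin L m hL U hα1 hU1 hreg) := fun v =>
  (exists_preimage_norm_le L m hL U hα1 hU1 hreg hαL v).imp fun _ h => h.1

variable {W : Type*} [NormedAddCommGroup W] [InnerProductSpace ℂ W] (φ : W ≃ₗ[ℂ] 𝔸) {c₀ c₁ : ℝ}

include hαL in
/-- **`Q(U)` read on the weighted `L²` spaces of `W`-valued bond functions (`B9Eq315QTorus.QtorusW`) is onto** (compositions with linear
equivalences). [cite: Balaban1985BackgroundPropagators, (3.15)–(3.16) p.393] -/
theorem QtorusW_surjective : Function.Surjective (QtorusW L m hL φ U hα1 hU1 hreg (c₀ := c₀) (c₁ := c₁)) := by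
  unfold QtorusW
  simp only [LinearMap.coe_comp]
  exact (LinearEquiv.surjective _).comp <| (LinearEquiv.surjective _).comp <| (QtorusLin_surjective L m hL U hα1 hU1 hreg hαL).comp <|
    (LinearEquiv.surjective _).comp (LinearEquiv.surjective _)

end Onto

/-! ## §4 The letters at `Q := Q(U)`: symmetry, and `G₁`/`H₁`/`𝔊` with «`Q` onto» discharged -/

section Letters

variable {𝔸 : Type*} [NormedRing 𝔸] [NormedAlgebra ℂ 𝔸] [CompleteSpace 𝔸] [NormOneClass 𝔸] [StarRing 𝔸] [StarModule ℂ 𝔸]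
  (L : ℕ) [NeZero L] (m : Fin d → ℕ) [∀ i, NeZero (fineP L m i)] (hL : 1 ≤ L)
  {W : Type*} [NormedAddCommGroup W] [InnerProductSpace ℂ W] [FiniteDimensional ℂ W] (φ : W ≃ₗ[ℂ] 𝔸) {c₀ c₁ : ℝ}
  [Fact (0 < c₀)] [Fact (0 < c₁)]
  (U : Bond d (fineP L m) → 𝔸ˣ) {α : ℝ} (hα1 : α ≤ 1 / 64)
  (hU1 : ∀ (x : B7Prop1Explicit.Site d) (κ : Fin d), perCfg (fineP L m) U x κ ∈ U1 𝔸)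
  (hreg : ∀ (y : TSite d m) (κ : Fin d) (r : Fin d → Fin L),
    ‖((Wcx L (perCfg (fineP L m) U) (cornerSite L y) κ (boxVec L r) : 𝔸ˣ) : 𝔸) - 1‖ ≤ α)
  (τ : 𝔸 →ₗ[ℂ] ℂ) (η : ℝ)

/-- **`Δ_a(U)` of (3.26) WITH `Q := Q(U)` IS SYMMETRIC** for a unitary background, a `*`-trace and the compatibility of the two normings
(E161 `laplaceAofU_isSymmetric` at `Q := QtorusW`). [cite: Balaban1985BackgroundPropagators, (3.26) p.395, (3.10) p.392; Balaban1985Variational, p.293] -/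
theorem laplaceAofBackground_isSymmetric (hU : ∀ b, star (U b : 𝔸) = ((U b)⁻¹ : 𝔸ˣ)) (hτ₁ : ∀ X : 𝔸, τ (star X) = conj (τ X))
    (hτ₂ : ∀ X Y : 𝔸, τ (X * Y) = τ (Y * X)) (hφ : ∀ X Y : 𝔸, ⟪φ.symm X, φ.symm Y⟫_ℂ = τ (star X * Y)) (a : ℝ) :
    (laplaceAofBackground L m hL φ U hα1 hU1 hreg τ η (c₀ := c₀) (c₁ := c₁) a).IsSymmetric :=
  laplaceAofU_isSymmetric L m φ τ η hU hτ₁ hτ₂ hφ _ a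

variable {a : ℝ} (hαL : 50 * (d + 1) * α * (L : ℝ) ^ d ≤ 1 / 2)
  (hpos : ∀ x : BondL2K ℂ d (fineP L m) c₀ W, x ≠ 0 →
    0 < RCLike.re ⟪x, laplaceAofBackground L m hL φ U hα1 hU1 hreg τ η (c₀ := c₀) (c₁ := c₁) a x⟫_ℂ)

/-- **`G₁(U) = Δ_a(U)⁻¹` at `Q := Q(U)`** (positivity = [B9] Thm 3.11, displayed). [cite: Balaban1985Variational, (110) p.294; Balaban1985BackgroundPropagators, Thm 3.11 p.416] -/
def G1ofBackground : BondL2K ℂ d (fineP L m) c₀ W →ₗ[ℂ] BondL2K ℂ d (fineP L m) c₀ W := G1ofU L m φ η U τ hpos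

/-- **`H₁(U) = G₁Q*(QG₁Q*)⁻¹` at `Q := Q(U)` — «`Q` onto» DISCHARGED by `QtorusW_surjective`**; displayed: positivity only.
[cite: Balaban1985BackgroundPropagators, (3.126) p.420; Balaban1985Variational, (45) p.285, (103) p.293] -/
def H1ofBackground : BondL2K ℂ d m c₁ W →ₗ[ℂ] BondL2K ℂ d (fineP L m) c₀ W :=
  H1ofU L m φ η U τ hpos (QtorusW_surjective L m hL U hα1 hU1 hreg hαL φ)

/-- **(45)₁ `Q(U)(H₁(U) b) = b`** at `Q := Q(U)`, hypothesis-free given the displayed positivity and the small-field regime.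
[cite: Balaban1985Variational, (45) p.285] -/
theorem Q_H1ofBackground (b : BondL2K ℂ d m c₁ W) :
    QtorusW L m hL φ U hα1 hU1 hreg (H1ofBackground L m hL φ U hα1 hU1 hreg τ η hαL hpos b) = b :=
  Q_H1ofU L m φ η U τ hpos _ b

/-- **`𝔊(U)`** of [B11] (110)–(111) / [B9] (3.153) at `Q := Q(U)`, «`Q` onto» discharged. [cite: Balaban1985Variational, (110)–(111) p.294] -/
def frakGofBackground : BondL2K ℂ d (fineP L m) c₀ W →ₗ[ℂ] BondL2K ℂ d (fineP L m) c₀ W :=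
  frakGofU L m φ η U τ hpos (QtorusW_surjective L m hL U hα1 hU1 hreg hαL φ)

end Letters

end Literature.MathematicalPhysics.QuantumFieldTheory.Balaban1983to89.B9Eq315QTorusOnto

end
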